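import Summits.AnomalousDissipation.AnomalousDissipation.Cruxes.EulerlimitThesisV2.Lines.tight
import Literature.Barriers.AnomalousDissipation.IntermittentDissipationCompactness
import Literature.Analysis.FunctionSpaces.TorusTimePeriodization

/-!
# STUB-PLAN sketch (stub-critic) — `stub_kolmogorovRieszPeriodicSlab` of line `tight`
(crux `EulerLimit.EulerlimitThesisV2`, stmt-AnomalousDissipation-0511)

Elaboration check of the MERGED plan `STUB-PLAN-stub_kolmogorovRieszPeriodicSlab.md`:

* §A the seven helper lemmas of the TOP plan (k3 Plan A "De Rosa–Isett §6.1 discharge with its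
  two PDE inputs swapped for the two axis slices of the Kolmogorov–Riesz modulus"), generic in the
  torus index `d` / the Banach space `E` — `sorry` bodies, these are what the helper FILES prove;
  H4 is RE-TYPED by the critic (smoothness hypothesis instead of bare measurability);
* §B the five REGISTERED SUB-STUB forms (`d = Fin 3`), each a one-line specialisation of §A —
  the exact strings for `ledger workitem stub-add stmt-AnomalousDissipation-0511 --name … --signature …`;
* §C the assembly of the registered stub from the §B forms ONLY (kernel-checked, no `sorry`);
* §D the by-name check that §C proves the registered statement
  `Tight.Statement.stub_kolmogorovRieszPeriodicSlab` (so the landing file's last theorem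
  `theorem stub_kolmogorovRieszPeriodicSlab : <verbatim> := …` will match).
-/

noncomputable section

set_option linter.dupNamespace false
set_option linter.unusedVariables false

open MeasureTheory TopologicalSpace Set Function Filter Metric UnitAddTorus
open scoped ENNReal NNReal Convolution Topology

namespace Summit.AnomalousDissipation.AnomalousDissipation.Cruxes.EulerlimitThesisV2.Tight.Plan

open Literature.Analysis.FunctionSpaces Literature.Analysis.FunctionSpaces.Torus
open Summit.AnomalousDissipation.AnomalousDissipation.Cruxes.EulerlimitThesisV2.Tight

/-! ## §A  Helper lemmas (generic; `sorry` = what the helper files prove) -/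

/-- **H1** — `L³(0,T)` bound from cell averages and an INTEGRAL modulus of continuity
(modulus analogue of `lintegral_enorm_pow_three_le_of_increments`, TimePartitionIncrements:188;
Hanche-Olsen–Holden 2010, proof of Thm 5). -/
theorem lintegral_enorm_pow_three_le_of_modulus
    {E : Type*} [NormedAddCommGroup E] [NormedSpace ℝ E] [CompleteSpace E]
    {T : ℝ} (hT : 0 < T) {F : ℝ → E} (hF : Continuous F) (L : ℕ) {Λ : ℝ≥0∞}
    (hmod : ∀ σ : ℝ, |σ| ≤ T / (L + 1) → ∫⁻ t in Ioo 0 T, ‖F (t + σ) - F t‖ₑ ^ 3 ≤ Λ) :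
    ∫⁻ t in Ioo 0 T, ‖F t‖ₑ ^ 3 ≤
      4 * ENNReal.ofReal ((L + 1 : ℝ) / T) ^ 2 *
          ∑ l ∈ Finset.range (L + 1),
            ‖∫ t in Ioo ((l : ℝ) * (T / (L + 1))) ((l + 1 : ℝ) * (T / (L + 1))), F t‖ₑ ^ 3 +
        8 * Λ := by
  sorry

/-- **H2** — `L³(0,T)` Cauchy from a uniform modulus and convergent cell averages
(modulus analogue of `exists_forall_lintegral_enorm_sub_pow_three_le_of_increments`, TimeIncrementsL3Cauchy:80). -/
theorem exists_forall_lintegral_enorm_sub_pow_three_le_of_modulus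
    {E : Type*} [NormedAddCommGroup E] [NormedSpace ℝ E] [CompleteSpace E]
    {T : ℝ} (hT : 0 < T) {F : ℕ → ℝ → E} (hF : ∀ n, Continuous (F n))
    (hmod : ∀ Λ : ℝ≥0∞, 0 < Λ → ∃ δ : ℝ, 0 < δ ∧ ∀ (n : ℕ) (σ : ℝ), |σ| ≤ δ →
      ∫⁻ t in Ioo 0 T, ‖F n (t + σ) - F n t‖ₑ ^ 3 ≤ Λ)
    (havg : ∀ L l : ℕ, l ≤ L → ∃ c : E, Tendsto
      (fun n => ∫ t in Ioo ((l : ℝ) * (T / (L + 1))) ((l + 1 : ℝ) * (T / (L + 1))), F n t)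
        atTop (𝓝 c))
    {η : ℝ≥0∞} (hη : 0 < η) :
    ∃ N : ℕ, ∀ n m : ℕ, N ≤ n → N ≤ m → ∫⁻ t in Ioo 0 T, ‖F n t - F m t‖ₑ ^ 3 ≤ η := by
  sorry

/-- **H3** — one subsequence with every Fourier mode Cauchy in `L³(0,T)`, from the TIME modulus
(copy-edit of `FluidPDE.exists_subseq_forall_modes_cauchy_L3`, ClassicalNSModeCompactness:163,
`hinc` ↦ `hmod`, last line ↦ H2). -/
theorem exists_subseq_forall_modes_cauchy_L3_of_modulus
    {d : Type*} [Fintype d] {T : ℝ} (hT : 0 < T)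
    {u : ℕ → ℝ → UnitAddTorus d → EuclideanSpace ℝ d}
    (hu : ∀ j, IsSmoothSpaceTimeOn univ (u j))
    {B : ℝ≥0∞} (hB : B ≠ ⊤) (hL3 : ∀ j, ∫⁻ t in Ioo 0 T, ∫⁻ x, ‖u j t x‖ₑ ^ 3 ≤ B)
    (hmod : ∀ Λ : ℝ≥0∞, 0 < Λ → ∃ δ : ℝ, 0 < δ ∧ ∀ (j : ℕ) (σ : ℝ), |σ| ≤ δ →
      ∫⁻ t in Ioo 0 T, ∫⁻ x, ‖u j (t + σ) x - u j t x‖ₑ ^ 3 ≤ Λ) :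
    ∃ φ : ℕ → ℕ, StrictMono φ ∧ ∀ (k : d → ℤ) (η : ℝ≥0∞), 0 < η → ∃ N : ℕ, ∀ n m : ℕ,
      N ≤ n → N ≤ m →
        ∫⁻ t in Ioo 0 T, ‖mFourierCoeff (EuclideanSpace.complexify ∘ u (φ n) t) k -
          mFourierCoeff (EuclideanSpace.complexify ∘ u (φ m) t) k‖ₑ ^ 3 ≤ η := by
  sorry

/-- **H4 (re-typed by the critic)** — time-integrated CET (6): the `L³((0,T)×T^d)` mollification
error is bounded by the SPACE slice of the modulus.  Smoothness on the open strip replaces k3's bare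
measurability hypotheses (it is what the assembly has, and it gives every measurability /
integrability side condition by name: `IsSmoothSpaceTimeOn.aestronglyMeasurable_uncurry_prod`,
`IsSmoothSpaceTimeOn.convolution`, `isSmooth_slice`).  Proof: `kernel_convolution_sub_self_apply`
pointwise, then `lintegral_rpow_enorm_integral_smul_le` (TorusMollifierEstimates:62) on
`X = ℝ × T^d` (measure `(vol|(0,T)) ⊗ vol`), `Y = T^d`, `k = kernel ε`, `Φ (t,x) y = w t (x-y) - w t x`,
`lintegral_enorm_kernel = 1`, `support_kernel_subset`, `lintegral_prod` twice. -/
theorem lintegral_lintegral_kernel_convolution_sub_self_le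
    {d : Type*} [Fintype d] {T : ℝ} (hT : 0 < T) {w : ℝ → UnitAddTorus d → EuclideanSpace ℝ d}
    (hw : IsSmoothSpaceTimeOn (Ioo 0 T) w)
    {ε : ℝ} (hε : 0 < ε) (hε' : ε ≤ 1 / 4) {Λ : ℝ≥0∞}
    (hmod : ∀ y : UnitAddTorus d, ‖y‖ ≤ ε →
      ∫⁻ t in Ioo 0 T, ∫⁻ x, ‖w t (x - y) - w t x‖ₑ ^ 3 ≤ Λ) :
    ∫⁻ t in Ioo 0 T, ∫⁻ x, ‖(kernel ε ⋆ w t) x - w t x‖ₑ ^ 3 ≤ Λ := by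
  sorry

/-- **H5** — `L³((0,T) × T^d)` Cauchy from a uniform mollification error in space and Cauchy modes
in time (copy-edit of `Torus.exists_forall_lintegral_sub_pow_three_le_of_modes`,
TorusSpaceTimeL3Cauchy:209: `hθ`, `hwB` ↦ `hwB` + `hmoll`; Step 1 `hεsmall` ↦ `hmoll ((ρ/6)^3)`,
`hhigh` immediate, `hwL3` from `hwB`). -/
theorem exists_forall_lintegral_sub_pow_three_le_of_modes_of_mollify
    {d : Type*} [Fintype d] [DecidableEq d] {T : ℝ} (hT : 0 < T)
    {w : ℕ → ℝ → UnitAddTorus d → EuclideanSpace ℝ d}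
    (hw : ∀ n, IsSmoothSpaceTimeOn (Ioo 0 T) (w n))
    {B : ℝ≥0∞} (hB : B ≠ ⊤)
    (hwB : ∀ n, ∫⁻ t in Ioo 0 T, ∫⁻ x, ‖w n t x‖ₑ ^ 3 ≤ B)
    (hmoll : ∀ ρ : ℝ≥0∞, 0 < ρ → ∃ ε : ℝ, 0 < ε ∧ ε ≤ 1 / 4 ∧ ∀ n,
      ∫⁻ t in Ioo 0 T, ∫⁻ x, ‖(kernel ε ⋆ w n t) x - w n t x‖ₑ ^ 3 ≤ ρ)
    (hmode : ∀ k : d → ℤ, ∀ η : ℝ≥0∞, 0 < η → ∃ N : ℕ, ∀ n m : ℕ, N ≤ n → N ≤ m →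
      ∫⁻ t in Ioo 0 T, ‖mFourierCoeff (EuclideanSpace.complexify ∘ w n t) k -
        mFourierCoeff (EuclideanSpace.complexify ∘ w m t) k‖ₑ ^ 3 ≤ η)
    {η : ℝ≥0∞} (hη : 0 < η) :
    ∃ N : ℕ, ∀ n m : ℕ, N ≤ n → N ≤ m →
      ∫⁻ t in Ioo 0 T, ∫⁻ x, ‖w n t x - w m t x‖ₑ ^ 3 ≤ η := by
  sorry

/-- **H6** — strong `L³((0,T) × T^d)` limit of a nested-`L³` Cauchy family (VERBATIM Steps 3–5 of
`DeRosaIsett2024_s61_compactness_holds`: `exists_fast_subseq`, `eLpNorm_uncurry_three_eq`,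
`rpow_third_le_rpow_third`, `pow_three_rpow_third`, `ENNReal.tsum_geometric_two`,
`Lp.cauchy_complete_eLpNorm`). -/
theorem exists_subseq_tendsto_of_cauchy_L3
    {d : Type*} [Fintype d] {T : ℝ}
    {W : ℕ → ℝ → UnitAddTorus d → EuclideanSpace ℝ d}
    (hWm : ∀ n, AEStronglyMeasurable (uncurry (W n)) ((volume.restrict (Ioo 0 T)).prod volume))
    {B : ℝ≥0∞} (hB : B ≠ ⊤) (hWB : ∀ n, ∫⁻ t in Ioo 0 T, ∫⁻ x, ‖W n t x‖ₑ ^ 3 ≤ B)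
    (hcau : ∀ η : ℝ≥0∞, 0 < η → ∃ N : ℕ, ∀ n m : ℕ, N ≤ n → N ≤ m →
      ∫⁻ t in Ioo 0 T, ∫⁻ x, ‖W n t x - W m t x‖ₑ ^ 3 ≤ η) :
    ∃ (ψ : ℕ → ℕ) (V : ℝ → UnitAddTorus d → EuclideanSpace ℝ d), StrictMono ψ ∧
      AEStronglyMeasurable (uncurry V) ((volume.restrict (Ioo 0 T)).prod volume) ∧
      Tendsto (fun n => ∫⁻ t in Ioo 0 T, ∫⁻ x, ‖W (ψ n) t x - V t x‖ₑ ^ 3) atTop (𝓝 0) := by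
  sorry

/-- **H7** — periodisation of the limit: `w := timePeriodize 0 τ V` (TorusTimePeriodization) —
`periodic_timePeriodize`, `timePeriodize_eq_self` on `Ico 0 τ ⊇ Ioo 0 τ`; measurability of
`stLift w` on `Ioo 0 τ ×ˢ univ` by `AEStronglyMeasurable.congr` from
`aestronglyMeasurable_stLift_of_uncurry hV` (TorusSpaceTimeFields:259) and the a.e.-equality on the
restricted set (`ae_restrict_mem`). -/
theorem exists_periodic_extension
    {d : Type*} [Fintype d] {F : Type*} [TopologicalSpace F]
    {τ : ℝ} (hτ : 0 < τ) (V : ℝ → UnitAddTorus d → F)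
    (hV : AEStronglyMeasurable (uncurry V) ((volume.restrict (Ioo 0 τ)).prod volume)) :
    ∃ w : ℝ → UnitAddTorus d → F, Function.Periodic w τ ∧ (∀ t ∈ Ioo 0 τ, w t = V t) ∧
      AEStronglyMeasurable (stLift w) (volume.restrict (Ioo 0 τ ×ˢ univ)) := by
  sorry

/-! ## §B  Registered sub-stub forms (`d = Fin 3`): the strings for `stub-add`

Each is literally the §A lemma at `d = Fin 3` with explicit binders and fully qualified names
(no scoped notation except `∫⁻ … in …,` and `‖·‖ₑ`, both already used by the registered stubs of
`Lines/tight.lean`).  A helper file proves the general lemma and ENDS with the corresponding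
`theorem stub_kr… : <string verbatim> := fun … => <general lemma> …`. -/

/-- Registered form of H3 (time direction; the file also contains H1, H2). -/
theorem stub_krTimeModesCauchy :
    ∀ (T : ℝ) (B : ENNReal) (u : ℕ → ℝ → UnitAddTorus (Fin 3) → EuclideanSpace ℝ (Fin 3)),
      0 < T → B ≠ ⊤ →
      (∀ j, Literature.Analysis.FunctionSpaces.Torus.IsSmoothSpaceTimeOn Set.univ (u j)) →
      (∀ j, ∫⁻ t in Set.Ioo 0 T, ∫⁻ x, ‖u j t x‖ₑ ^ 3 ≤ B) →
      (∀ Λ : ENNReal, 0 < Λ → ∃ δ : ℝ, 0 < δ ∧ ∀ (j : ℕ) (σ : ℝ), |σ| ≤ δ →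
        ∫⁻ t in Set.Ioo 0 T, ∫⁻ x, ‖u j (t + σ) x - u j t x‖ₑ ^ 3 ≤ Λ) →
      ∃ φ : ℕ → ℕ, StrictMono φ ∧ ∀ (k : Fin 3 → ℤ) (η : ENNReal), 0 < η → ∃ N : ℕ, ∀ n m : ℕ,
        N ≤ n → N ≤ m →
          ∫⁻ t in Set.Ioo 0 T,
            ‖UnitAddTorus.mFourierCoeff (Literature.Analysis.FunctionSpaces.EuclideanSpace.complexify ∘ u (φ n) t) k -
              UnitAddTorus.mFourierCoeff (Literature.Analysis.FunctionSpaces.EuclideanSpace.complexify ∘ u (φ m) t) k‖ₑ ^ 3 ≤ η :=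
  fun T B u hT hB hu hL3 hmod => exists_subseq_forall_modes_cauchy_L3_of_modulus hT hu hB hL3 hmod

/-- Registered form of H4 (space direction, mollification error). -/
theorem stub_krMollifyError :
    ∀ (T : ℝ) (w : ℝ → UnitAddTorus (Fin 3) → EuclideanSpace ℝ (Fin 3)) (ε : ℝ) (Λ : ENNReal),
      0 < T → Literature.Analysis.FunctionSpaces.Torus.IsSmoothSpaceTimeOn (Set.Ioo 0 T) w →
      0 < ε → ε ≤ 1 / 4 →
      (∀ y : UnitAddTorus (Fin 3), ‖y‖ ≤ ε →
        ∫⁻ t in Set.Ioo 0 T, ∫⁻ x, ‖w t (x - y) - w t x‖ₑ ^ 3 ≤ Λ) →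
      ∫⁻ t in Set.Ioo 0 T, ∫⁻ x,
        ‖MeasureTheory.convolution (Literature.Analysis.FunctionSpaces.Torus.kernel ε) (w t)
            (ContinuousLinearMap.lsmul ℝ ℝ) MeasureTheory.volume x - w t x‖ₑ ^ 3 ≤ Λ :=
  fun T w ε Λ hT hw hε hε' hmod => lintegral_lintegral_kernel_convolution_sub_self_le hT hw hε hε' hmod

/-- Registered form of H5 (space–time `L³` Cauchy criterion). -/
theorem stub_krSpaceTimeCauchy :
    ∀ (T : ℝ) (B : ENNReal) (w : ℕ → ℝ → UnitAddTorus (Fin 3) → EuclideanSpace ℝ (Fin 3)),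
      0 < T → B ≠ ⊤ →
      (∀ n, Literature.Analysis.FunctionSpaces.Torus.IsSmoothSpaceTimeOn (Set.Ioo 0 T) (w n)) →
      (∀ n, ∫⁻ t in Set.Ioo 0 T, ∫⁻ x, ‖w n t x‖ₑ ^ 3 ≤ B) →
      (∀ ρ : ENNReal, 0 < ρ → ∃ ε : ℝ, 0 < ε ∧ ε ≤ 1 / 4 ∧ ∀ n,
        ∫⁻ t in Set.Ioo 0 T, ∫⁻ x,
          ‖MeasureTheory.convolution (Literature.Analysis.FunctionSpaces.Torus.kernel ε) (w n t)
              (ContinuousLinearMap.lsmul ℝ ℝ) MeasureTheory.volume x - w n t x‖ₑ ^ 3 ≤ ρ) →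
      (∀ k : Fin 3 → ℤ, ∀ η : ENNReal, 0 < η → ∃ N : ℕ, ∀ n m : ℕ, N ≤ n → N ≤ m →
        ∫⁻ t in Set.Ioo 0 T,
          ‖UnitAddTorus.mFourierCoeff (Literature.Analysis.FunctionSpaces.EuclideanSpace.complexify ∘ w n t) k -
            UnitAddTorus.mFourierCoeff (Literature.Analysis.FunctionSpaces.EuclideanSpace.complexify ∘ w m t) k‖ₑ ^ 3 ≤ η) →
      ∀ η : ENNReal, 0 < η → ∃ N : ℕ, ∀ n m : ℕ, N ≤ n → N ≤ m →
        ∫⁻ t in Set.Ioo 0 T, ∫⁻ x, ‖w n t x - w m t x‖ₑ ^ 3 ≤ η :=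
  fun T B w hT hB hw hwB hmoll hmode η hη =>
    exists_forall_lintegral_sub_pow_three_le_of_modes_of_mollify hT hw hB hwB hmoll hmode hη

/-- Registered form of H6 (strong limit of a Cauchy family). -/
theorem stub_krLimitOfCauchy :
    ∀ (T : ℝ) (B : ENNReal) (W : ℕ → ℝ → UnitAddTorus (Fin 3) → EuclideanSpace ℝ (Fin 3)),
      (∀ n, MeasureTheory.AEStronglyMeasurable (Function.uncurry (W n))
        ((MeasureTheory.volume.restrict (Set.Ioo 0 T)).prod MeasureTheory.volume)) →
      B ≠ ⊤ → (∀ n, ∫⁻ t in Set.Ioo 0 T, ∫⁻ x, ‖W n t x‖ₑ ^ 3 ≤ B) →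
      (∀ η : ENNReal, 0 < η → ∃ N : ℕ, ∀ n m : ℕ, N ≤ n → N ≤ m →
        ∫⁻ t in Set.Ioo 0 T, ∫⁻ x, ‖W n t x - W m t x‖ₑ ^ 3 ≤ η) →
      ∃ (ψ : ℕ → ℕ) (V : ℝ → UnitAddTorus (Fin 3) → EuclideanSpace ℝ (Fin 3)), StrictMono ψ ∧
        MeasureTheory.AEStronglyMeasurable (Function.uncurry V)
          ((MeasureTheory.volume.restrict (Set.Ioo 0 T)).prod MeasureTheory.volume) ∧
        Filter.Tendsto (fun n => ∫⁻ t in Set.Ioo 0 T, ∫⁻ x, ‖W (ψ n) t x - V t x‖ₑ ^ 3)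
          Filter.atTop (nhds 0) :=
  fun T B W hWm hB hWB hcau => exists_subseq_tendsto_of_cauchy_L3 hWm hB hWB hcau

/-- Registered form of H7 (periodic extension of the limit). -/
theorem stub_krPeriodicExtension :
    ∀ (τ : ℝ) (V : ℝ → UnitAddTorus (Fin 3) → EuclideanSpace ℝ (Fin 3)), 0 < τ →
      MeasureTheory.AEStronglyMeasurable (Function.uncurry V)
        ((MeasureTheory.volume.restrict (Set.Ioo 0 τ)).prod MeasureTheory.volume) →
      ∃ w : ℝ → UnitAddTorus (Fin 3) → EuclideanSpace ℝ (Fin 3), Function.Periodic w τ ∧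
        (∀ t ∈ Set.Ioo 0 τ, w t = V t) ∧
        MeasureTheory.AEStronglyMeasurable (Literature.Analysis.FunctionSpaces.Torus.stLift w)
          (MeasureTheory.volume.restrict (Set.Ioo 0 τ ×ˢ Set.univ)) :=
  fun τ V hτ hV => exists_periodic_extension hτ V hV

/-! ## §C  Assembly of the registered stub from the five §B forms only -/

/-- The physical flat unit torus `𝕋³` (local notation). -/
local notation "𝕋³" => UnitAddTorus (Fin 3)
/-- Velocity values (local notation). -/
local notation "E³" => EuclideanSpace ℝ (Fin 3)

/-- **Assembly** (k3's checked composition, rewired to the registered forms): Step 0 bound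
`B := ofReal M` and the two AXIS SLICES of the modulus in `ℝ≥0∞` form; Step 1 `stub_krTimeModesCauchy`
→ `φ₁`; Step 2 `stub_krMollifyError` → `hmoll` along `φ₁`; Step 3 `stub_krSpaceTimeCauchy` → Cauchy;
Step 4 `stub_krLimitOfCauchy` → `ψ, V`; Step 5 `stub_krPeriodicExtension` → `w`; `φ := φ₁ ∘ ψ`. -/
theorem stub_kolmogorovRieszPeriodicSlab_of_helpers :
    ∀ (τ M : ℝ) (v : ℕ → ℝ → 𝕋³ → E³), 0 < τ →
      (∀ j, IsSmoothSpaceTimeOn Set.univ (v j)) →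
      (∀ j, Function.Periodic (v j) τ) →
      (∀ j, ∫⁻ t in Set.Ioo 0 τ, ∫⁻ x, ‖v j t x‖ₑ ^ 3 ≤ ENNReal.ofReal M) →
      (∀ ε : ℝ, 0 < ε → ∃ δ : ℝ, 0 < δ ∧ ∀ (j : ℕ) (s : ℝ) (h : 𝕋³), |s| ≤ δ → ‖h‖ ≤ δ →
        ∫⁻ t in Set.Ioo 0 τ, ∫⁻ x, ‖v j (t + s) (x + h) - v j t x‖ₑ ^ 3 ≤ ENNReal.ofReal ε) →
      ∃ (w : ℝ → 𝕋³ → E³) (φ : ℕ → ℕ), StrictMono φ ∧ Function.Periodic w τ ∧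
        AEStronglyMeasurable (stLift w) (volume.restrict (Set.Ioo 0 τ ×ˢ Set.univ)) ∧
        Tendsto (fun j => ∫⁻ t in Set.Ioo 0 τ, ∫⁻ x, ‖v (φ j) t x - w t x‖ₑ ^ 3)
          atTop (𝓝 0) := by
  intro τ M v hτ hsm _hper hM hKR
  -- Step 0: the bound and the two AXIS SLICES of the modulus, in `ℝ≥0∞` form
  have hB : ENNReal.ofReal M ≠ ⊤ := ENNReal.ofReal_ne_top
  have hsm' : ∀ j, IsSmoothSpaceTimeOn (Ioo 0 τ) (v j) := fun j => (hsm j).mono (subset_univ _)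
  have hmodT : ∀ Λ : ℝ≥0∞, 0 < Λ → ∃ δ : ℝ, 0 < δ ∧ ∀ (j : ℕ) (σ : ℝ), |σ| ≤ δ →
      ∫⁻ t in Ioo 0 τ, ∫⁻ x, ‖v j (t + σ) x - v j t x‖ₑ ^ 3 ≤ Λ := by
    intro Λ hΛ
    rcases eq_or_ne Λ ⊤ with hΛt | hΛt
    · exact ⟨1, one_pos, fun j σ _ => hΛt ▸ le_top⟩
    obtain ⟨δ, hδ, hδ'⟩ := hKR Λ.toReal (ENNReal.toReal_pos hΛ.ne' hΛt)
    refine ⟨δ, hδ, fun j σ hσ => ?_⟩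
    have h := hδ' j σ 0 hσ (by simpa using hδ.le)
    simpa only [add_zero, ENNReal.ofReal_toReal hΛt] using h
  have hmodX : ∀ Λ : ℝ≥0∞, 0 < Λ → ∃ δ : ℝ, 0 < δ ∧ ∀ (j : ℕ) (y : 𝕋³), ‖y‖ ≤ δ →
      ∫⁻ t in Ioo 0 τ, ∫⁻ x, ‖v j t (x - y) - v j t x‖ₑ ^ 3 ≤ Λ := by
    intro Λ hΛ
    rcases eq_or_ne Λ ⊤ with hΛt | hΛt
    · exact ⟨1, one_pos, fun j y _ => hΛt ▸ le_top⟩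
    obtain ⟨δ, hδ, hδ'⟩ := hKR Λ.toReal (ENNReal.toReal_pos hΛ.ne' hΛt)
    refine ⟨δ, hδ, fun j y hy => ?_⟩
    have h := hδ' j 0 (-y) (by simpa using hδ.le) (by rwa [norm_neg])
    simpa only [add_zero, ← sub_eq_add_neg, ENNReal.ofReal_toReal hΛt] using h
  -- Step 1 (H3, fed by H1/H2): a subsequence `φ₁` with Cauchy Fourier modes in `L³(0,τ)`
  obtain ⟨φ₁, hφ₁, hmodes⟩ := stub_krTimeModesCauchy τ _ v hτ hB hsm hM hmodT
  -- Step 2 (H4): uniform mollification error from the SPACE modulus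
  have hmoll : ∀ ρ : ℝ≥0∞, 0 < ρ → ∃ ε : ℝ, 0 < ε ∧ ε ≤ 1 / 4 ∧ ∀ n,
      ∫⁻ t in Ioo 0 τ, ∫⁻ x, ‖(kernel ε ⋆ v (φ₁ n) t) x - v (φ₁ n) t x‖ₑ ^ 3 ≤ ρ := by
    intro ρ hρ
    obtain ⟨δ, hδ, hδ'⟩ := hmodX ρ hρ
    refine ⟨min δ (1 / 4), lt_min hδ (by norm_num), min_le_right _ _, fun n => ?_⟩
    exact stub_krMollifyError τ (v (φ₁ n)) _ ρ hτ (hsm' (φ₁ n)) (lt_min hδ (by norm_num))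
      (min_le_right _ _) (fun y hy => hδ' (φ₁ n) y (hy.trans (min_le_left _ _)))
  -- Step 3 (H5): Cauchy in `L³((0,τ) × 𝕋³)` along `φ₁`
  have hcau : ∀ η : ℝ≥0∞, 0 < η → ∃ N : ℕ, ∀ n m : ℕ, N ≤ n → N ≤ m →
      ∫⁻ t in Ioo 0 τ, ∫⁻ x, ‖v (φ₁ n) t x - v (φ₁ m) t x‖ₑ ^ 3 ≤ η := fun η hη =>
    stub_krSpaceTimeCauchy τ _ (fun n => v (φ₁ n)) hτ hB (fun n => hsm' (φ₁ n))
      (fun n => hM (φ₁ n)) hmoll hmodes η hη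
  -- Step 4 (H6): the strong limit `V` along a further subsequence `ψ`
  obtain ⟨ψ, V, hψ, hVm, hlim⟩ := stub_krLimitOfCauchy τ _ (fun n => v (φ₁ n))
    (fun n => (hsm' (φ₁ n)).aestronglyMeasurable_uncurry_prod) hB (fun n => hM (φ₁ n)) hcau
  -- Step 5 (H7): periodise the representative
  obtain ⟨w, hwper, hwV, hwm⟩ := stub_krPeriodicExtension τ V hτ hVm
  refine ⟨w, φ₁ ∘ ψ, hφ₁.comp hψ, hwper, hwm, ?_⟩
  have heq : ∀ n, ∫⁻ t in Ioo 0 τ, ∫⁻ x, ‖v ((φ₁ ∘ ψ) n) t x - w t x‖ₑ ^ 3 =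
      ∫⁻ t in Ioo 0 τ, ∫⁻ x, ‖v (φ₁ (ψ n)) t x - V t x‖ₑ ^ 3 := fun n =>
    setLIntegral_congr_fun measurableSet_Ioo fun t ht => by simp only [Function.comp_apply, hwV t ht]
  simp_rw [heq]
  exact hlim

/-! ## §D  The assembly proves the REGISTERED statement by name -/

/-- The plan's assembly closes `Tight.Statement.stub_kolmogorovRieszPeriodicSlab` (the by-name handle
of the registered stub in `Lines/tight.lean`).  The landing file's last theorem is therefore
`theorem stub_kolmogorovRieszPeriodicSlab : <registered signature verbatim> := stub_kolmogorovRieszPeriodicSlab_of_helpers`. -/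
theorem plan_closes_registered_stub : Statement.stub_kolmogorovRieszPeriodicSlab :=
  stub_kolmogorovRieszPeriodicSlab_of_helpers

/-- Type identity with the registered (sorried) stub itself. -/
example : @Tight.stub_kolmogorovRieszPeriodicSlab = @stub_kolmogorovRieszPeriodicSlab_of_helpers := rfl

end Summit.AnomalousDissipation.AnomalousDissipation.Cruxes.EulerlimitThesisV2.Tight.Plan

end
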